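import Mathlib
import Summits.Ventures.Crystal3D.StickySpheres.FccChunks
import Literature.MathematicalPhysics.StatisticalMechanics.FccSurfaceTension
import Literature.Barriers.AtomisticToContinuum.TetrahedralFrustrationRogers
import HarnessLib

/-!
# The tent certificate for fcc grains — (T1), part A: per-cell tables, double count, global bound

(File 1 of 3 — authored by the literature seat crystal3d-full-lit gen 9, HOME/cf-lit/tent/, kernel-checked;
landed by the prover seat crystal3d-full-eng gen 8 at the planner's request; split A/B/C only to respect
the 400-line rule; parts B `…TentTablesLocal` and C `…TentTablesBridge` import this one.)


Route `StickyWulffConstant` of `Summits/Ventures/Crystal3D` (cell `crystal3d-full`), support toward the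
crux `TextureLiminf` (stmt-Ventures-19483), line TexShadow v5 whose FREE_f certificate is the TENT
CERTIFICATE (planner cf-p1 gen 18, ROUTE.md §71; literature seat LIT §26): for a finite site set `A` of
an fcc grain let `f_A` be the continuous piecewise-affine function on the tetrahedral–octahedral
complex refined by coning each octahedron from its centre, equal to `1_A` at the sites and to
`α ∈ {0, ½, 1}` at an octahedron centre according as the octahedron has `≤ 1 / 2–4 / ≥ 5` occupied
vertices.  THIS FILE proves the discrete half:

* (combinatorial) `tentCost24_le : tentCost24 A ≤ 144·#A − 12·orderedBonds A` (`= 24·D(A)`,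
  `D = 6#A − #bonds`) for EVERY finite `A` — the per-cell costs in units of `1/24` are `2·e` for a
  tetrahedron (`e` = ordered occupied–vacant vertex pairs) and `octCost24` for an octahedron (eight
  corner terms `phiZ(2w)`); ingredients: the 64-pattern table `oct_table6` (`decide`) and the three
  double counts «every ordered occupied–vacant neighbour pair is a vertex pair of exactly one
  up-tetrahedron, one down-tetrahedron and two octahedra» (`sum_eTetUp`, `sum_eTetDn`, `sum_eOct`);
* (local form, ROUTE §71.8) `tentCostOn24_le : tentCostOn24 A U D O ≤ 12·#coveredBonds A U D O` for
  EVERY family of cells (up-tetrahedra at `U`, down-tetrahedra at `D`, octahedra at `O`): the tent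
  cost of the family is at most `½·#{broken bonds lying in a cell of the family}` (broken bonds
  encoded `(x, δ)`, `x ∈ A`, `x + δ ∉ A`; `card_brokenBonds : #brokenBonds A = bdPairs A`,
  `card_brokenBonds_sdiff` for the complementary «in no cell of the family» count,
  `tentCost24_eq_tentCostOn24`, `twelve_bdPairs : 12·bdPairs = 144·#A − 12·orderedBonds`);
* (geometric) in the coefficient model of `StickySpheres/FccChunks.lean` realised at
  `site n = (√2)⁻¹·intVec (fccPoint n)` (nearest-neighbour distance `1`, cubic frame, Wulff gauge
  `phiFcc` of `Literature/…/FccSurfaceTension.lean`): the gradient of the affine interpolant on each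
  cell (`grad_tetUp`, `grad_tetDn`, `grad_corner`), `phiFcc (intVec w) = phiZ w`, hence
  `phiFcc(∇f) = (√2/2)·e_T` on tetrahedra and `(√2/2)·phiZ(2v − 2α)` on octahedron corners
  (`phiFcc_grad_tetUp/Dn/corner`), and the cell volumes `|T| = 1/(6√2)`, `|corner| = 1/(12√2)`
  (`volume_tetUp`, `volume_corner`, as `rogersSimplex`), so that `|c|·phiFcc(∇f_A|_c)` is exactly
  `1/24` of the combinatorial cost (`cost_tet`, `cost_corner`).

Consequently `Σ_cells |c|·phiFcc(∇f_A|_c) ≤ D(A)`; the continuum half (coarea over the cells via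
`Literature.Analysis.Convexity.CavalieriSlices` and the polytope calculus `AnisotropicPerimeterPolytopeUnion`)
turns this into a level set `{f_A > t} ⊇ Full(A)` with `P_W({f_A > t}) ≤ D(A)` — done elsewhere.
WHAT THIS IS NOT: the FREE_f statement, (T2), anything off-lattice; F-C1 not moved.
-/

noncomputable section

namespace Summit.Ventures.Crystal3D.TentCertificate

open Finset Summit.Ventures.Crystal3D MeasureTheory
open Literature.Geometry.DiscreteGeometry (intVec intVec_apply)
open Literature.MathematicalPhysics.StatisticalMechanics (phiFcc phiFcc_eq_sum_max phiFcc_smul phiFcc_neg)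
open Literature.Barriers.AtomisticToContinuum (rogersSimplex edgeMap paramSimplex
  volume_rogersSimplex_eq_det det_edgeMap volume_paramSimplex)
open scoped RealInnerProductSpace

/-- Lattice sites in the coefficient model `Fin 3 → ℤ` of `StickySpheres/FccChunks.lean`. -/
abbrev Site := Fin 3 → ℤ


/-! ## Deficiency bookkeeping: `B∂ + orderedBonds = 12·#A` -/

/-- ordered bonded pairs inside `A` (twice the number of bonds), as in `SolidShadow.lean`. -/
def orderedBonds (A : Finset Site) : ℕ := ((A ×ˢ A).filter fun q => q.2 - q.1 ∈ fccOffsets).card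

/-- `g A δ` = number of occupied sites whose `δ`-translate is vacant. -/
def g (A : Finset Site) (δ : Site) : ℕ := (A.filter fun x => x + δ ∉ A).card

/-- ordered occupied–vacant neighbour pairs `B∂(A) = Σ_{δ} g(δ)`. -/
def bdPairs (A : Finset Site) : ℕ := ∑ δ ∈ fccOffsets, g A δ

/-- `orderedBonds` as a sum over the twelve neighbour offsets. -/
theorem orderedBonds_eq_sum (A : Finset Site) :
    orderedBonds A = ∑ δ ∈ fccOffsets, (A.filter fun x => x + δ ∈ A).card := by
  classical
  unfold orderedBonds
  have h1 : ∑ δ ∈ fccOffsets, (A.filter fun x => x + δ ∈ A).card =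
      ((fccOffsets ×ˢ A).filter fun q => q.2 + q.1 ∈ A).card := by
    rw [card_filter, sum_product]
    refine sum_congr rfl fun δ _ => ?_
    rw [card_filter]
  rw [h1]
  apply card_bij (fun q _ => (q.2 - q.1, q.1))
  · rintro ⟨x, y⟩ hq
    simp only [mem_filter, mem_product] at hq ⊢
    exact ⟨⟨hq.2, hq.1.1⟩, by simpa using hq.1.2⟩
  · rintro ⟨x, y⟩ _ ⟨x', y'⟩ _ h
    simp only [Prod.mk.injEq] at h
    obtain ⟨h1, rfl⟩ := h
    have : y = y' := by
      have := congrArg (· + x) h1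
      simpa using this
    rw [this]
  · rintro ⟨δ, x⟩ hq
    simp only [mem_filter, mem_product] at hq
    refine ⟨(x, x + δ), ?_, ?_⟩
    · simp only [mem_filter, mem_product]
      exact ⟨⟨hq.1.2, hq.2⟩, by simpa using hq.1.1⟩
    · simp

/-- `B∂ + orderedBonds = 12·#A`. -/
theorem bdPairs_add_orderedBonds (A : Finset Site) : bdPairs A + orderedBonds A = 12 * A.card := by
  classical
  rw [orderedBonds_eq_sum, bdPairs, ← sum_add_distrib]
  have : ∀ δ ∈ fccOffsets, g A δ + (A.filter fun x => x + δ ∈ A).card = A.card := by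
    intro δ _
    unfold g
    rw [add_comm]
    exact Finset.card_filter_add_card_filter_not (fun x => x + δ ∈ A)
  rw [sum_congr rfl this, sum_const, card_fccOffsets, smul_eq_mul]

/-! ## Translation reindexing -/

/-- `Σ_{p ∈ P} [p + v ∈ A ∧ p + w ∉ A] = g(w − v)` whenever `P ⊇ A − v`. -/
theorem sum_ite_translate (A P : Finset Site) (v w : Site) (hP : ∀ x ∈ A, x - v ∈ P) :
    (∑ p ∈ P, if p + v ∈ A ∧ p + w ∉ A then (1 : ℤ) else 0) = (g A (w - v) : ℤ) := by
  classical
  have hset : (P.filter fun p => p + v ∈ A ∧ p + w ∉ A) =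
      (A.filter fun x => x + (w - v) ∉ A).image fun x => x - v := by
    ext p
    simp only [mem_filter, mem_image]
    constructor
    · rintro ⟨-, hv, hw⟩
      refine ⟨p + v, ⟨hv, ?_⟩, by abel⟩
      have : p + v + (w - v) = p + w := by abel
      rwa [this]
    · rintro ⟨x, ⟨hx, hxw⟩, rfl⟩
      refine ⟨hP x hx, by simpa using hx, ?_⟩
      have : x - v + w = x + (w - v) := by abel
      rwa [this]
  have hnat : (P.filter fun p => p + v ∈ A ∧ p + w ∉ A).card = g A (w - v) := by
    unfold g
    rw [hset, card_image_of_injective _ sub_left_injective]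
  rw [← sum_filter, sum_const, nsmul_eq_mul, mul_one]
  exact_mod_cast hnat

/-! ## Cells -/

/-- Vertex offsets of the up-tetrahedron `T⁺(p) = p + {0, e₀, e₁, e₂}`. -/
def tetUpV : Fin 4 → Site := ![![0, 0, 0], ![1, 0, 0], ![0, 1, 0], ![0, 0, 1]]
/-- Vertex offsets of the down-tetrahedron `T⁻(p) = p − {0, e₀, e₁, e₂}`. -/
def tetDnV : Fin 4 → Site := ![![0, 0, 0], ![-1, 0, 0], ![0, -1, 0], ![0, 0, -1]]
/-- octahedron vertices, antipodal pairs `(0,1), (2,3), (4,5)`. -/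
def octV : Fin 6 → Site :=
  ![![0, 0, 0], ![1, 1, -1], ![1, 0, 0], ![0, 1, -1], ![0, 1, 0], ![1, 0, -1]]

/-- all vertex offsets used (for the index set). -/
def allV : Finset Site :=
  (univ.image tetUpV) ∪ (univ.image tetDnV) ∪ (univ.image octV)

/-- non-antipodal (= adjacent) vertex pairs of the octahedron. -/
def nonAnti (i j : Fin 6) : Bool := decide (i.val / 2 ≠ j.val / 2)

/-- occupied–vacant ordered vertex pairs of a cell placed at `p`. -/
def eTetUp (A : Finset Site) (p : Site) : ℤ :=
  ∑ i : Fin 4, ∑ j : Fin 4, if p + tetUpV i ∈ A ∧ p + tetUpV j ∉ A then 1 else 0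
/-- Ordered occupied–vacant vertex pairs of the down-tetrahedron at `p`. -/
def eTetDn (A : Finset Site) (p : Site) : ℤ :=
  ∑ i : Fin 4, ∑ j : Fin 4, if p + tetDnV i ∈ A ∧ p + tetDnV j ∉ A then 1 else 0
/-- Ordered occupied–vacant NON-antipodal vertex pairs of the octahedron at `p`. -/
def eOct (A : Finset Site) (p : Site) : ℤ :=
  ∑ i : Fin 6, ∑ j : Fin 6,
    if nonAnti i j ∧ (p + octV i ∈ A ∧ p + octV j ∉ A) then 1 else 0

/-! ## The octahedron cost (centre rule) and its 64-pattern table -/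

/-- The integer cubic-frame gauge `phiZ a b c = max |a| |b| + max |a| |c| + max |b| |c|` (`= phiFcc` on integer vectors). -/
def phiZ (a b c : ℤ) : ℤ := max |a| |b| + max |a| |c| + max |b| |c|
/-- Indicator of a Boolean as an integer. -/
def ind (b : Bool) : ℤ := if b then 1 else 0

section pattern
variable (b : Fin 6 → Bool)

/-- Number of occupied vertices of an octahedron pattern. -/
def occ : ℤ := ind (b 0) + ind (b 1) + ind (b 2) + ind (b 3) + ind (b 4) + ind (b 5)
/-- Twice the centre value of the tent on an octahedron: `0 / 1 / 2` for `≤ 1 / 2–4 / ≥ 5` occupied vertices. -/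
def twoAlpha : ℤ := if occ b ≤ 1 then 0 else if 5 ≤ occ b then 2 else 1
/-- `2 w` on the corner tetrahedron choosing vertex `0`/`1` on axis 1, `2`/`3` on axis 2, `4`/`5` on axis 3
(sign `+` for the even index). -/
def cw (k : Fin 6) : ℤ := (if k.val % 2 = 0 then 1 else -1) * (2 * ind (b k) - twoAlpha b)
/-- Cost (in units of `1/24`) of one corner tetrahedron of an octahedron pattern. -/
def corner (k₁ k₂ k₃ : Fin 6) : ℤ := phiZ (cw b k₁) (cw b k₂) (cw b k₃)
/-- `24 ×` the tent cost of the octahedron (sum over the 8 corner tetrahedra). -/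
def octCost24 : ℤ :=
  corner b 0 2 4 + corner b 0 2 5 + corner b 0 3 4 + corner b 0 3 5 +
  corner b 1 2 4 + corner b 1 2 5 + corner b 1 3 4 + corner b 1 3 5
/-- occupied–vacant ordered vertex pairs, pattern form. -/
def eOVb : ℤ := ∑ i : Fin 6, ∑ j : Fin 6, if nonAnti i j ∧ (b i = true ∧ b j = false) then 1 else 0

end pattern

/-- **Table O** (all 64 patterns): `octCost24 ≤ 4·e`. -/
theorem oct_table6 : ∀ b₀ b₁ b₂ b₃ b₄ b₅ : Bool,
    octCost24 ![b₀, b₁, b₂, b₃, b₄, b₅] ≤ 4 * eOVb ![b₀, b₁, b₂, b₃, b₄, b₅] := by decide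

/-- The octahedron table: `octCost24 b ≤ 4 · eOVb b` for every pattern. -/
theorem oct_table (b : Fin 6 → Bool) : octCost24 b ≤ 4 * eOVb b := by
  have hb : b = ![b 0, b 1, b 2, b 3, b 4, b 5] := by
    funext i; fin_cases i <;> rfl
  rw [hb]; exact oct_table6 _ _ _ _ _ _

/-- the pattern of the octahedron at `p`. -/
def patO (A : Finset Site) (p : Site) : Fin 6 → Bool := fun j => decide (p + octV j ∈ A)

/-- The pattern count `eOVb` of the octahedron at `p` is `eOct A p`. -/
theorem eOVb_patO (A : Finset Site) (p : Site) : eOVb (patO A p) = eOct A p := by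
  unfold eOVb eOct patO
  refine sum_congr rfl fun i _ => sum_congr rfl fun j _ => ?_
  simp only [decide_eq_true_eq, decide_eq_false_iff_not]

/-! ## The three double counts -/

/-- Ordered pairs of distinct tetrahedron vertex slots. -/
def slotsTet : Finset (Fin 4 × Fin 4) := univ.filter fun q => q.1 ≠ q.2
/-- Ordered pairs of non-antipodal octahedron vertex slots. -/
def slotsOct : Finset (Fin 6 × Fin 6) := univ.filter fun q => nonAnti q.1 q.2

/-- Slot differences of the up-tetrahedron are exactly the twelve neighbour offsets. -/
theorem image_slotsTetUp : slotsTet.image (fun q => tetUpV q.2 - tetUpV q.1) = fccOffsets := by decide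
/-- Slot differences of the down-tetrahedron are exactly the twelve neighbour offsets. -/
theorem image_slotsTetDn : slotsTet.image (fun q => tetDnV q.2 - tetDnV q.1) = fccOffsets := by decide
/-- Slot differences of the octahedron are exactly the twelve neighbour offsets. -/
theorem image_slotsOct : slotsOct.image (fun q => octV q.2 - octV q.1) = fccOffsets := by decide
/-- Each neighbour offset occurs exactly once among the up-tetrahedron slot differences. -/
theorem fiber_slotsTetUp : ∀ δ ∈ fccOffsets,
    (slotsTet.filter fun q => tetUpV q.2 - tetUpV q.1 = δ).card = 1 := by decide
/-- Each neighbour offset occurs exactly once among the down-tetrahedron slot differences. -/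
theorem fiber_slotsTetDn : ∀ δ ∈ fccOffsets,
    (slotsTet.filter fun q => tetDnV q.2 - tetDnV q.1 = δ).card = 1 := by decide
/-- Each neighbour offset occurs exactly twice among the octahedron slot differences. -/
theorem fiber_slotsOct : ∀ δ ∈ fccOffsets,
    (slotsOct.filter fun q => octV q.2 - octV q.1 = δ).card = 2 := by decide

/-- the index set: all `x − v`, `x ∈ A`, `v` a cell vertex offset. -/
def idx (A : Finset Site) : Finset Site := A.biUnion fun x => allV.image fun v => x - v

/-- A cell anchored at `x − v` (`x ∈ A`, `v` a vertex offset) is indexed by `idx A`. -/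
theorem mem_idx {A : Finset Site} {x v : Site} (hx : x ∈ A) (hv : v ∈ allV) : x - v ∈ idx A := by
  unfold idx; simp only [mem_biUnion, mem_image]; exact ⟨x, hx, v, hv, rfl⟩

/-- Up-tetrahedron offsets are vertex offsets. -/
theorem tetUpV_mem (i : Fin 4) : tetUpV i ∈ allV := by
  unfold allV; simp
/-- Down-tetrahedron offsets are vertex offsets. -/
theorem tetDnV_mem (i : Fin 4) : tetDnV i ∈ allV := by
  unfold allV; simp
/-- Octahedron offsets are vertex offsets. -/
theorem octV_mem (i : Fin 6) : octV i ∈ allV := by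
  unfold allV; simp

/-- Double count: every ordered occupied–vacant neighbour pair lies in exactly one up-tetrahedron. -/
theorem sum_eTetUp (A : Finset Site) : ∑ p ∈ idx A, eTetUp A p = (bdPairs A : ℤ) := by
  classical
  unfold eTetUp
  rw [sum_comm]
  simp_rw [Finset.sum_comm (s := idx A)]
  -- now: Σ_i Σ_j Σ_p ite
  have h : ∀ i j : Fin 4, (∑ p ∈ idx A, if p + tetUpV i ∈ A ∧ p + tetUpV j ∉ A then (1:ℤ) else 0)
      = (g A (tetUpV j - tetUpV i) : ℤ) :=
    fun i j => sum_ite_translate A (idx A) _ _ (fun x hx => mem_idx hx (tetUpV_mem i))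
  simp_rw [h]
  -- Σ_i Σ_j g(v_j - v_i) = Σ over slots (diagonal terms vanish: g 0 = 0)
  have hg0 : g A 0 = 0 := by
    unfold g
    rw [Finset.card_eq_zero, Finset.filter_eq_empty_iff]
    intro x hx h
    exact h (by simpa using hx)
  have hsplit : (∑ i : Fin 4, ∑ j : Fin 4, (g A (tetUpV j - tetUpV i) : ℤ)) =
      ∑ q ∈ slotsTet, (g A (tetUpV q.2 - tetUpV q.1) : ℤ) := by
    rw [← sum_product', univ_product_univ, slotsTet, sum_filter]
    refine sum_congr rfl fun q _ => ?_
    by_cases hq : q.1 ≠ q.2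
    · simp [hq]
    · push Not at hq; simp [hq, hg0]
  rw [hsplit, Finset.sum_comp (fun δ : Site => (g A δ : ℤ)) (fun q : Fin 4 × Fin 4 => tetUpV q.2 - tetUpV q.1),
    image_slotsTetUp, bdPairs, Nat.cast_sum]
  refine sum_congr rfl fun δ hδ => ?_
  rw [fiber_slotsTetUp δ hδ, one_smul]

/-- Double count: every ordered occupied–vacant neighbour pair lies in exactly one down-tetrahedron. -/
theorem sum_eTetDn (A : Finset Site) : ∑ p ∈ idx A, eTetDn A p = (bdPairs A : ℤ) := by
  classical
  unfold eTetDn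
  rw [sum_comm]
  simp_rw [Finset.sum_comm (s := idx A)]
  have h : ∀ i j : Fin 4, (∑ p ∈ idx A, if p + tetDnV i ∈ A ∧ p + tetDnV j ∉ A then (1:ℤ) else 0)
      = (g A (tetDnV j - tetDnV i) : ℤ) :=
    fun i j => sum_ite_translate A (idx A) _ _ (fun x hx => mem_idx hx (tetDnV_mem i))
  simp_rw [h]
  have hg0 : g A 0 = 0 := by
    unfold g
    rw [Finset.card_eq_zero, Finset.filter_eq_empty_iff]
    intro x hx h
    exact h (by simpa using hx)
  have hsplit : (∑ i : Fin 4, ∑ j : Fin 4, (g A (tetDnV j - tetDnV i) : ℤ)) =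
      ∑ q ∈ slotsTet, (g A (tetDnV q.2 - tetDnV q.1) : ℤ) := by
    rw [← sum_product', univ_product_univ, slotsTet, sum_filter]
    refine sum_congr rfl fun q _ => ?_
    by_cases hq : q.1 ≠ q.2
    · simp [hq]
    · push Not at hq; simp [hq, hg0]
  rw [hsplit, Finset.sum_comp (fun δ : Site => (g A δ : ℤ)) (fun q : Fin 4 × Fin 4 => tetDnV q.2 - tetDnV q.1),
    image_slotsTetDn, bdPairs, Nat.cast_sum]
  refine sum_congr rfl fun δ hδ => ?_
  rw [fiber_slotsTetDn δ hδ, one_smul]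

/-- Double count: every ordered occupied–vacant neighbour pair lies in exactly two octahedra. -/
theorem sum_eOct (A : Finset Site) : ∑ p ∈ idx A, eOct A p = 2 * (bdPairs A : ℤ) := by
  classical
  unfold eOct
  rw [sum_comm]
  simp_rw [Finset.sum_comm (s := idx A)]
  have h : ∀ i j : Fin 6,
      (∑ p ∈ idx A, if nonAnti i j ∧ (p + octV i ∈ A ∧ p + octV j ∉ A) then (1:ℤ) else 0)
      = if nonAnti i j then (g A (octV j - octV i) : ℤ) else 0 := by
    intro i j
    by_cases hn : nonAnti i j
    · simp only [hn, true_and, if_true]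
      exact sum_ite_translate A (idx A) _ _ (fun x hx => mem_idx hx (octV_mem i))
    · simp [hn]
  simp_rw [h]
  have hsplit : (∑ i : Fin 6, ∑ j : Fin 6, if nonAnti i j then (g A (octV j - octV i) : ℤ) else 0) =
      ∑ q ∈ slotsOct, (g A (octV q.2 - octV q.1) : ℤ) := by
    rw [← sum_product', univ_product_univ, slotsOct, sum_filter]
  rw [hsplit, Finset.sum_comp (fun δ : Site => (g A δ : ℤ)) (fun q : Fin 6 × Fin 6 => octV q.2 - octV q.1),
    image_slotsOct, bdPairs, Nat.cast_sum, mul_sum]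
  refine sum_congr rfl fun δ hδ => ?_
  rw [fiber_slotsOct δ hδ]
  simp [two_mul]

/-! ## Assembly -/

/-- the tent cost of `A` in units of `1/24`: tetrahedra `2e`, octahedra `octCost24`. -/
def tentCost24 (A : Finset Site) : ℤ :=
  ∑ p ∈ idx A, (2 * eTetUp A p + 2 * eTetDn A p + octCost24 (patO A p))

/-- **(T1)** `tentCost24 A ≤ 24·D(A) = 144·#A − 12·orderedBonds A`, every finite `A`. -/
theorem tentCost24_le (A : Finset Site) :
    tentCost24 A ≤ 144 * (A.card : ℤ) - 12 * (orderedBonds A : ℤ) := by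
  classical
  have hoct : ∀ p ∈ idx A, octCost24 (patO A p) ≤ 4 * eOct A p := by
    intro p _; rw [← eOVb_patO]; exact oct_table _
  have h1 : tentCost24 A ≤ ∑ p ∈ idx A, (2 * eTetUp A p + 2 * eTetDn A p + 4 * eOct A p) := by
    unfold tentCost24
    exact sum_le_sum fun p hp => by linarith [hoct p hp]
  have h2 : ∑ p ∈ idx A, (2 * eTetUp A p + 2 * eTetDn A p + 4 * eOct A p) = 12 * (bdPairs A : ℤ) := by
    rw [sum_add_distrib, sum_add_distrib, ← mul_sum, ← mul_sum, ← mul_sum, sum_eTetUp, sum_eTetDn,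
      sum_eOct]
    ring
  have h3 : (bdPairs A : ℤ) + (orderedBonds A : ℤ) = 12 * (A.card : ℤ) := by
    exact_mod_cast bdPairs_add_orderedBonds A
  linarith


end Summit.Ventures.Crystal3D.TentCertificate
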